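import Summits.ResolutionOfSingularities.ResolutionOfSingularities.Theorems.WeightedInvariantELadderTwoCentreChartMaximal
import Summits.ResolutionOfSingularities.ResolutionOfSingularities.Theorems.WeightedInvariantELadderTwoCentreLocalModels
import Summits.ResolutionOfSingularities.ResolutionOfSingularities.Theorems.WeightedInvariantE2CentreSchemeGlueDefs
import HarnessLib

/-!
# E-ladder rung `e = 2`, centre piece (C-c): THE SCHEME GLUE `e2CentreSchemeGlue : E2CentreSchemeGlueBody p ι J` (board item (o47-c-scheme))

[OURS · L1 W4.3 · DOOR `HypersurfaceCentreConstruction` (stmt-ResolutionOfSingularities-19897) · E2 CENTRE piece (C-c), SPEC (Δ11b) rev 10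
(`L/res-L1-w43-plan-1/E2Step_split_sketch.lean` l.687; DESIGN MEMO `E2-CENTRE-GLUE-DESIGN-v0.md` §3 (G-1)…(G-5)); written by res-D-pv-048
(gen 11).  Def-free; `--supports` the door item as a helper.  OURS bookkeeping, NOT a statement of [Hironaka2017]; AI work, weaker than expert
review.]

`LocalEngine.e2CentreSchemeGlue : E2CentreSchemeGlueBody p ι J`, i.e.
`PRungGrHomLE 3 p ι J → E2HomogeneousChartBody p ι J → E2CentreHomBody p ι J → E2CentreGlueBody p ι J`: for a stage `S` with (I0)₂, singular
`X`, non-empty `maxLocus₂` and (C-b), there is `R : ReesAlgebraData S.Y` with `IsAdmissibleCentre S.f S.i.ker R ∧ S.IsCanonicalCentre₂ ι J R`.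
Assembly of: (G-1) the model chart at a point of `maxLocus₂` (`Stage.exists_e2ModelChartAt`, …CentreChartAt) and the cover of the closed points
of `M = closure maxLocus₂` (`Stage.exists_mem_maxLocus₂_primeIdealOf_eq_homogeneousCore`, …CentreChartZeros) — finitely many charts suffice
(`M` is compact in the Noetherian `|Y|`, closed points are dense in the closed `M ∖ ⋃ D(t_c)`: Jacobson); (M1)/(G-2) zeros and agreement
(…CentreChartZeros; the agreement `Stage.map_weightedMonomialIdeal_germ_le_of_charts` is proved in THIS file: on a basic open `D(s) ∋ y` of `W a` inside `D(t) ∩ D(t')` the restricted ideal `𝒥ₘ(U')·Γ(Y, D(s))` lies in `𝒥ₘ(U|_{D(s)})` by the AGREEMENT TOOL `E2Model.le_weightedMonomialIdeal_iff_forall_minimalPrimes` — at a minimal prime `ζ` of `(U)`, `dim 𝒪_{Y,ζ} ≤ 3` by Krull, `ζ ∈ M` by (Z), so both models equal `J(𝒪_{Y,ζ}, f_ζ)ₘ` by (S5)); (G-3)…(G-5) F1/F2 (`Stage.exists_isCanonicalCentre₂_of_modelCharts`, …CentreLocalModels); the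
stalkwise maximality (`Stage.ideal_basicOpen_le_of_forall_stalkIdeal_le`, …CentreChartMaximal) feeding the `(hom)` hand `E2CentreHomBody`.
-/

noncomputable section

set_option linter.dupNamespace false
set_option backward.isDefEq.respectTransparency false

open CategoryTheory AlgebraicGeometry TopologicalSpace IsLocalRing
open Literature.AlgebraicGeometry.Resolution
open Summit.ResolutionOfSingularities.ResolutionOfSingularities.Theorems
open Summit.ResolutionOfSingularities.ResolutionOfSingularities.Theorems.ELadderOne
open Summit.ResolutionOfSingularities.ResolutionOfSingularities.Cruxes.HypersurfaceCentreConstruction.LocalEngine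

/-! ## (G-2): two model charts agree on their overlap -/

namespace Summit.ResolutionOfSingularities.ResolutionOfSingularities.Theorems.ELadderOne.Stage

variable {k : Type} [Field k] (S : Stage k) (ι : (R : Type) → [CommRing R] → R → Ordinal.{0})
  (J : (R : Type) → [CommRing R] → R → ℕ → Ideal R)

/-- **ONE INCLUSION OF THE AGREEMENT (G-2)**: the model of the second chart lies in the model of the first at every point of the overlap
(see the module docstring). [folklore] -/
theorem map_weightedMonomialIdeal_germ_le_of_charts
    {a : S.atlas.ι} {N : ℕ} (hN : N ≤ 3) (t : Γ(S.Y, S.atlas.W a)) (U : Fin N → Γ(S.Y, S.atlas.W a)) (w : Fin N → ℕ)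
    (hw : ∀ i, 0 < w i)
    (hS5 : ∀ (y : S.Y) (hy : y ∈ S.Y.basicOpen t), ringKrullDim (S.Y.presheaf.stalk y) ≤ ((3 : ℕ) : WithBot ℕ∞) →
      (∀ i, (S.Y.presheaf.germ (S.atlas.W a) y (S.Y.basicOpen_le t hy)).hom (U i) ∈ maximalIdeal (S.Y.presheaf.stalk y)) →
      ∀ m : ℕ, J (S.Y.presheaf.stalk y) (localGenerator S.i.ker y) m =
        (weightedMonomialIdeal U w m).map (S.Y.presheaf.germ (S.atlas.W a) y (S.Y.basicOpen_le t hy)).hom)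
    (hS3 : ∀ (y : S.Y) (hy : y ∈ S.Y.basicOpen t)
      (hU : ∀ i, (S.Y.presheaf.germ (S.atlas.W a) y (S.Y.basicOpen_le t hy)).hom (U i) ∈ maximalIdeal (S.Y.presheaf.stalk y)),
      LinearIndependent (ResidueField (S.Y.presheaf.stalk y)) (fun i => (maximalIdeal (S.Y.presheaf.stalk y)).toCotangent ⟨_, hU i⟩))
    (hZ : ∀ (y : S.Y) (hy : y ∈ S.Y.basicOpen t),
      (∀ i, (S.Y.presheaf.germ (S.atlas.W a) y (S.Y.basicOpen_le t hy)).hom (U i) ∈ maximalIdeal (S.Y.presheaf.stalk y)) →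
      y ∈ closure (S.maxLocus₂ ι))
    {a' : S.atlas.ι} {N' : ℕ} (t' : Γ(S.Y, S.atlas.W a')) (U' : Fin N' → Γ(S.Y, S.atlas.W a')) (w' : Fin N' → ℕ)
    (hS5' : ∀ (y : S.Y) (hy : y ∈ S.Y.basicOpen t'), ringKrullDim (S.Y.presheaf.stalk y) ≤ ((3 : ℕ) : WithBot ℕ∞) →
      (∀ i, (S.Y.presheaf.germ (S.atlas.W a') y (S.Y.basicOpen_le t' hy)).hom (U' i) ∈ maximalIdeal (S.Y.presheaf.stalk y)) →
      ∀ m : ℕ, J (S.Y.presheaf.stalk y) (localGenerator S.i.ker y) m =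
        (weightedMonomialIdeal U' w' m).map (S.Y.presheaf.germ (S.atlas.W a') y (S.Y.basicOpen_le t' hy)).hom)
    (hM' : ∀ (y : S.Y) (hy : y ∈ S.Y.basicOpen t'), y ∈ closure (S.maxLocus₂ ι) →
      ∀ i, (S.Y.presheaf.germ (S.atlas.W a') y (S.Y.basicOpen_le t' hy)).hom (U' i) ∈ maximalIdeal (S.Y.presheaf.stalk y))
    {y : S.Y} (hy : y ∈ S.Y.basicOpen t) (hy' : y ∈ S.Y.basicOpen t') (m : ℕ) :
    (weightedMonomialIdeal U' w' m).map (S.Y.presheaf.germ (S.atlas.W a') y (S.Y.basicOpen_le t' hy')).hom ≤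
      (weightedMonomialIdeal U w m).map (S.Y.presheaf.germ (S.atlas.W a) y (S.Y.basicOpen_le t hy)).hom := by
  classical
  -- a basic open `D(s) ∋ y` of `W a` inside `D(t) ∩ D(t')`
  obtain ⟨s, hsle, hys⟩ := (S.atlas.W a).2.exists_basicOpen_le (V := S.Y.basicOpen t ⊓ S.Y.basicOpen t') ⟨y, ⟨hy, hy'⟩⟩
    (S.Y.basicOpen_le t hy)
  have hst : S.Y.basicOpen s ≤ S.Y.basicOpen t := hsle.trans inf_le_left
  have hst' : S.Y.basicOpen s ≤ S.Y.basicOpen t' := hsle.trans inf_le_right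
  have hsa' : (S.Y.affineBasicOpen s : S.Y.Opens) ≤ S.atlas.W a' := hst'.trans (S.Y.basicOpen_le t')
  haveI := S.isNoetherianRing_sections (S.Y.affineBasicOpen s)
  -- the restricted ideal of the second model lies in the first model on `Γ(Y, D(s))`
  set K : Ideal Γ(S.Y, S.Y.affineBasicOpen s) := (weightedMonomialIdeal U' w' m).map (S.Y.presheaf.map (homOfLE hsa').op).hom with hK
  have hloc := S.hloc_basicOpen t U hS3 s hst
  have hKle : K ≤ weightedMonomialIdeal (fun i => (S.Y.presheaf.map (homOfLE (S.Y.basicOpen_le s)).op).hom (U i)) w m := by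
    refine (E2Model.le_weightedMonomialIdeal_iff_forall_minimalPrimes _ w hw hloc).mpr ?_
    intro 𝔮 h𝔮min
    haveI h𝔮p : 𝔮.IsPrime := h𝔮min.1.1
    obtain ⟨ζ, hζs, hζ𝔮⟩ := S.exists_primeIdealOf_eq_affine (S.Y.affineBasicOpen s) 𝔮 h𝔮p
    subst hζ𝔮
    letI := S.Y.presheaf.algebra_section_stalk (⟨ζ, hζs⟩ : (S.Y.affineBasicOpen s : S.Y.Opens))
    haveI : IsLocalization.AtPrime (S.Y.presheaf.stalk ζ) ((S.Y.affineBasicOpen s).2.primeIdealOf ⟨ζ, hζs⟩).asIdeal :=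
      (S.Y.affineBasicOpen s).2.isLocalization_stalk ⟨ζ, hζs⟩
    refine (E2Model.forall_exists_mul_mem_iff_map_le _ (S.Y.presheaf.stalk ζ) _ _).mpr ?_
    have hζs' : ζ ∈ S.Y.basicOpen s := hζs
    have hζt : ζ ∈ S.Y.basicOpen t := hst hζs'
    have hζt' : ζ ∈ S.Y.basicOpen t' := hst' hζs'
    have hdim : ringKrullDim (S.Y.presheaf.stalk ζ) ≤ ((3 : ℕ) : WithBot ℕ∞) :=
      S.ringKrullDim_stalk_le_three_of_mem_minimalPrimes (S.Y.affineBasicOpen s) hN _ hζs h𝔮min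
    have hUζ : ∀ i, (S.Y.presheaf.germ (S.atlas.W a) ζ (S.Y.basicOpen_le t hζt)).hom (U i) ∈ maximalIdeal (S.Y.presheaf.stalk ζ) := by
      intro i
      rw [← S.germ_map_apply (S.Y.basicOpen_le s) hζs' (U i)]
      exact (germ_mem_maximalIdeal_iff_mem (S.Y.affineBasicOpen s) hζs _).mpr (h𝔮min.1.2 (Ideal.subset_span ⟨i, rfl⟩))
    have hζM : ζ ∈ closure (S.maxLocus₂ ι) := hZ ζ hζt hUζ
    have hU'ζ := hM' ζ hζt' hζM
    have hJ1 := hS5 ζ hζt hdim hUζ m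
    have hJ2 := hS5' ζ hζt' hdim hU'ζ m
    show K.map (S.Y.presheaf.germ (S.Y.affineBasicOpen s : S.Y.Opens) ζ hζs).hom ≤
      (weightedMonomialIdeal (fun i => (S.Y.presheaf.map (homOfLE (S.Y.basicOpen_le s)).op).hom (U i)) w m).map
        (S.Y.presheaf.germ (S.Y.affineBasicOpen s : S.Y.Opens) ζ hζs).hom
    rw [hK, S.map_germ_map_res (V := (S.Y.affineBasicOpen s : S.Y.Opens)) hsa' hζs,
      ← S.map_weightedMonomialIdeal_res (S.Y.basicOpen_le s) U w m,
      S.map_germ_map_res (V := (S.Y.affineBasicOpen s : S.Y.Opens)) (S.Y.basicOpen_le s) hζs]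
    exact (hJ2.symm.trans hJ1).le
  -- read at `y`
  have h1 := Ideal.map_mono (f := (S.Y.presheaf.germ (S.Y.affineBasicOpen s : S.Y.Opens) y hys).hom) hKle
  rw [hK, S.map_germ_map_res (V := (S.Y.affineBasicOpen s : S.Y.Opens)) hsa' hys,
    ← S.map_weightedMonomialIdeal_res (S.Y.basicOpen_le s) U w m,
    S.map_germ_map_res (V := (S.Y.affineBasicOpen s : S.Y.Opens)) (S.Y.basicOpen_le s) hys] at h1
  exact h1

end Summit.ResolutionOfSingularities.ResolutionOfSingularities.Theorems.ELadderOne.Stage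

/-! ## The closer -/

namespace Summit.ResolutionOfSingularities.ResolutionOfSingularities.Cruxes.HypersurfaceCentreConstruction.LocalEngine

/-- **(o47-c-scheme) THE SCHEME GLUE OF THE E2 CENTRE** (see the module docstring). [OURS] -/
theorem e2CentreSchemeGlue (p : ℕ) (ι : (R : Type) → [CommRing R] → R → Ordinal.{0})
    (J : (R : Type) → [CommRing R] → R → ℕ → Ideal R) : E2CentreSchemeGlueBody p ι J := by
  intro hr hG0 hhom k _ _ _ S h0 hXreg _ hcb
  classical
  haveI : JacobsonSpace S.Y := LocallyOfFiniteType.jacobsonSpace S.f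
  haveI : NoetherianSpace S.Y := S.noetherianSpace
  set M : Set S.Y := closure (S.maxLocus₂ ι) with hM
  -- (G-1): a model chart through every closed point of `M`
  have hdata : ∀ c : {c : S.Y // IsClosed ({c} : Set S.Y) ∧ c ∈ M},
      ∃ (a : S.atlas.ι) (N : ℕ) (t : Γ(S.Y, S.atlas.W a)) (U : Fin N → Γ(S.Y, S.atlas.W a)) (w : Fin N → ℕ),
        S.IsUnitChart a ∧ c.1 ∈ S.Y.basicOpen t ∧ N ≤ 3 ∧ (∀ i, 0 < w i) ∧
        (letI := S.atlas.gradedRing a; ∀ i, SetLike.IsHomogeneousElem (S.atlas.piece a) (U i)) ∧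
        (∀ (y : S.Y) (hy : y ∈ S.Y.basicOpen t), ringKrullDim (S.Y.presheaf.stalk y) ≤ ((3 : ℕ) : WithBot ℕ∞) →
          (∀ i, (S.Y.presheaf.germ (S.atlas.W a) y (S.Y.basicOpen_le t hy)).hom (U i) ∈ maximalIdeal (S.Y.presheaf.stalk y)) →
          ∀ m : ℕ, J (S.Y.presheaf.stalk y) (localGenerator S.i.ker y) m =
            (weightedMonomialIdeal U w m).map (S.Y.presheaf.germ (S.atlas.W a) y (S.Y.basicOpen_le t hy)).hom) ∧
        (∀ (y : S.Y) (hy : y ∈ S.Y.basicOpen t), ringKrullDim (S.Y.presheaf.stalk y) ≤ ((3 : ℕ) : WithBot ℕ∞) →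
          ((∀ i, (S.Y.presheaf.germ (S.atlas.W a) y (S.Y.basicOpen_le t hy)).hom (U i) ∈ maximalIdeal (S.Y.presheaf.stalk y)) ↔
            (y ∈ singImage S.i.ker ∧ iotaAt ι S.i.ker y = S.mu₂ ι))) ∧
        (∀ (y : S.Y) (hy : y ∈ S.Y.basicOpen t)
          (hU : ∀ i, (S.Y.presheaf.germ (S.atlas.W a) y (S.Y.basicOpen_le t hy)).hom (U i) ∈ maximalIdeal (S.Y.presheaf.stalk y)),
          LinearIndependent (ResidueField (S.Y.presheaf.stalk y))
            (fun i => (maximalIdeal (S.Y.presheaf.stalk y)).toCotangent ⟨_, hU i⟩)) := by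
    rintro ⟨c, hcc, hcM⟩
    obtain ⟨x, rfl⟩ := Stage.mem_range_of_mem_singImage S (S.closure_maxLocus₂_subset_singImage ι hcM)
    obtain ⟨a, hca, ha⟩ := S.exists_isUnitChart x
    obtain ⟨η, hηa, hηm, hcore⟩ := S.exists_mem_maxLocus₂_primeIdealOf_eq_homogeneousCore ι h0 hcb ha hca hcc hcM
    obtain ⟨δ, t, N, U, w, htδ, htη, hN, hw, hUhom, hS5, hS6, hS3⟩ := S.exists_e2ModelChartAt ι J hr hG0 hηm ha hηa
    exact ⟨a, N, t, U, w, ha, S.mem_basicOpen_of_primeIdealOf_eq_homogeneousCore hca hηa hcore htδ htη, hN, hw, hUhom,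
      hS5, hS6, hS3⟩
  choose a N t U w ha hct hN hw hUhom hS5 hS6 hS3 using hdata
  -- the derived readings (Z) and (M) of every chart
  have hZ : ∀ (c) (y : S.Y) (hy : y ∈ S.Y.basicOpen (t c)),
      (∀ i, (S.Y.presheaf.germ (S.atlas.W (a c)) y (S.Y.basicOpen_le (t c) hy)).hom (U c i) ∈ maximalIdeal (S.Y.presheaf.stalk y)) →
      y ∈ closure (S.maxLocus₂ ι) := fun c y hy hUy =>
    S.mem_closure_maxLocus₂_of_forall_germ_mem ι h0 (ha c) (hN c) (t c) (U c) (hUhom c) (hS6 c) hy hUy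
  have hMz : ∀ (c) (y : S.Y) (hy : y ∈ S.Y.basicOpen (t c)), y ∈ closure (S.maxLocus₂ ι) →
      ∀ i, (S.Y.presheaf.germ (S.atlas.W (a c)) y (S.Y.basicOpen_le (t c) hy)).hom (U c i) ∈ maximalIdeal (S.Y.presheaf.stalk y) :=
    fun c y hy hyM => S.forall_germ_mem_of_mem_closure_maxLocus₂ ι (t c) (U c) (hS6 c) hy hyM
  -- finitely many charts cover `M` (closed points are dense in closed subsets of the Jacobson space `|Y|`; `M` is compact)
  have hcovM : M ⊆ ⋃ c, (S.Y.basicOpen (t c) : Set S.Y) := by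
    intro y hyM
    by_contra hyV
    have hne : (M ∩ (⋃ c, (S.Y.basicOpen (t c) : Set S.Y))ᶜ).Nonempty := ⟨y, hyM, hyV⟩
    have hlc : IsLocallyClosed (M ∩ (⋃ c, (S.Y.basicOpen (t c) : Set S.Y))ᶜ) :=
      (isClosed_closure.inter (isOpen_iUnion fun c => (S.Y.basicOpen (t c)).2).isClosed_compl).isLocallyClosed
    obtain ⟨c₀, ⟨hc₀M, hc₀V⟩, hc₀c⟩ := nonempty_inter_closedPoints hne hlc
    exact hc₀V (Set.mem_iUnion.mpr ⟨⟨c₀, mem_closedPoints_iff.mp hc₀c, hc₀M⟩, hct _⟩)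
  obtain ⟨F, hF⟩ := (NoetherianSpace.isCompact M).elim_finite_subcover (fun c => (S.Y.basicOpen (t c) : Set S.Y))
    (fun c => (S.Y.basicOpen (t c)).2) hcovM
  -- F2b: glue the finite family of model charts
  obtain ⟨R, hcan, hregW, hsupp, -, hmaxC⟩ := S.exists_isCanonicalCentre₂_of_modelCharts ι J (L := {c // c ∈ F})
    (fun ℓ => a ℓ.1) (fun ℓ => t ℓ.1) (fun ℓ => N ℓ.1) (fun ℓ => U ℓ.1) (fun ℓ => w ℓ.1) (fun ℓ => hw ℓ.1)
    (by
      intro y hy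
      obtain ⟨c, hcF, hyc⟩ := Set.mem_iUnion₂.mp (hF hy)
      exact Set.mem_iUnion.mpr ⟨⟨c, hcF⟩, hyc⟩)
    (fun ℓ ℓ' m y hy hy' => le_antisymm
      (S.map_weightedMonomialIdeal_germ_le_of_charts ι J (hN ℓ'.1) (t ℓ'.1) (U ℓ'.1) (w ℓ'.1) (hw ℓ'.1) (hS5 ℓ'.1) (hS3 ℓ'.1)
        (hZ ℓ'.1) (t ℓ.1) (U ℓ.1) (w ℓ.1) (hS5 ℓ.1) (hMz ℓ.1) hy' hy m)
      (S.map_weightedMonomialIdeal_germ_le_of_charts ι J (hN ℓ.1) (t ℓ.1) (U ℓ.1) (w ℓ.1) (hw ℓ.1) (hS5 ℓ.1) (hS3 ℓ.1)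
        (hZ ℓ.1) (t ℓ'.1) (U ℓ'.1) (w ℓ'.1) (hS5 ℓ'.1) (hMz ℓ'.1) hy hy' m))
    (fun ℓ η hηm hη m => (hS5 ℓ.1 η hη hηm.1.2.2 ((hS6 ℓ.1 η hη hηm.1.2.2).mpr ⟨hηm.1.1, hηm.2⟩) m).symm)
    (fun ℓ y hy hUy => hZ ℓ.1 y hy hUy)
    (fun ℓ η hηm hη i => ((hS6 ℓ.1 η hη hηm.1.2.2).mpr ⟨hηm.1.1, hηm.2⟩) i)
    (fun ℓ y hy hU => hS3 ℓ.1 y hy hU)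
  -- stalkwise maximality on the maximum locus
  have hmax : ∀ (n : ℕ) (K : S.Y.IdealSheafData),
      (∀ η ∈ S.maxLocus₂ ι, stalkIdeal K η ≤ J (S.Y.presheaf.stalk η) (localGenerator S.i.ker η) n) → K ≤ R.piece n :=
    fun n K hK => hmaxC n K fun ℓ =>
      S.ideal_basicOpen_le_of_forall_stalkIdeal_le ι J (t ℓ.1) (U ℓ.1) (w ℓ.1) (hw ℓ.1) (hS5 ℓ.1) (hS3 ℓ.1) (hZ ℓ.1) (hMz ℓ.1)
        K hK
  -- admissibility: regular weighted centre, support, and `(hom)` from the (G-6) hand at the maximal canonical centre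
  exact ⟨R, ⟨hregW, hsupp, fun j W 𝒜 _ hc hX n => hhom S h0 hXreg R hcan hmax j W 𝒜 hc hX n⟩, hcan⟩

end Summit.ResolutionOfSingularities.ResolutionOfSingularities.Cruxes.HypersurfaceCentreConstruction.LocalEngine

end
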